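import Mathlib
import Literature.NumberTheory.Sieve.ParityBarrier

/-!
# `DilatedChowla` from binary-forms Chowla (crux `FanDecorrelation`, line `SketchIdeator5`)

Stub `stub_dilatedChowlaOfBinaryForms` of the crux `FanDecorrelation`
(`Summit.Parity.GeneralizedHardyLittlewood.Theses.LiouvilleMAD`, stmt-Parity-13318), line
`SketchIdeator5`, added by the continuation lead c3 when the line's pointwise half was reshaped onto
ONE clean conjecture, *binary-forms Chowla* (stub 3a of the skeleton
`Cruxes/FanDecorrelation/Lines/SketchIdeator5.lean`):

> there are `κ > 0` and `C` such that `|Σ_{u ∈ (X, X+L]} λ(un₁ + a₁) λ(un₂ + a₂)| ≤ C · X^{1−κ}`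
> for all `L ≤ X`, dilations `1 ≤ n₁, n₂ ≤ 2X`, shifts `|aᵢ| ≤ 2nᵢX` with `nᵢX + aᵢ > 0`, provided
> the two linear forms are not proportional (`n₁a₂ ≠ n₂a₁`).

This file records, as one importable theorem, that the route's rank-4 crux `DilatedChowla`
(stmt-Parity-13319: `|Σ_{m∈(M,2M]} λ(mn+c)λ(mn'+c)| ≤ C·M^{1−κ}` for `c ≠ 0`, `1 ≤ n ≠ n' ≤ 2M`) is
the instance `X = L = M`, `a₁ = a₂ = c` of that conjecture: the conclusion below is the body of
`DilatedChowla` verbatim, so `fun h => stub_dilatedChowlaOfBinaryForms h` proves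
`BinaryFormsChowla → DilatedChowla` by `unfold`.  (The same conjecture gives the pointwise half of
`FanDecorrelation`: stub `stub_pointwiseOfBinaryForms`.)

Proof: the forms `(n, c)` and `(n', c)` are non-proportional because `c ≠ 0` and `n ≠ n'`; for
`M > |c|` all side conditions hold (`nM + c > 0`, `|c| ≤ 2nM`); for `M ≤ |c|` the trivial bound
`|S| ≤ M ≤ |c|` suffices.  The exponent is capped at `κ' = min κ (1/2)` so that `M^{1−κ'} ≥ 1`, and
`C' = max C 0 + |c|`.
-/

namespace Summit.Parity.GeneralizedHardyLittlewood.Theorems.FanDecorrelation.DilatedChowlaOfBinaryForms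

open Literature.NumberTheory.Sieve (abs_liouville_le_one)

/-- Trivial bound for the dilated Chowla sum: `|Σ_{m∈(M,2M]} λ(mn+c)λ(mn'+c)| ≤ M`. [folklore] -/
theorem abs_dilatedSum_le (c : ℤ) (M n n' : ℕ) :
    |∑ m ∈ Finset.Ioc M (2 * M),
        (ArithmeticFunction.liouville (Int.toNat ((m : ℤ) * n + c)) : ℝ) *
          (ArithmeticFunction.liouville (Int.toNat ((m : ℤ) * n' + c)) : ℝ)| ≤ M := by
  calc _ ≤ ∑ m ∈ Finset.Ioc M (2 * M),
        |(ArithmeticFunction.liouville (Int.toNat ((m : ℤ) * n + c)) : ℝ) *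
          (ArithmeticFunction.liouville (Int.toNat ((m : ℤ) * n' + c)) : ℝ)| :=
        Finset.abs_sum_le_sum_abs _ _
    _ ≤ ∑ _m ∈ Finset.Ioc M (2 * M), (1 : ℝ) := by
        refine Finset.sum_le_sum fun m _ => ?_
        rw [abs_mul]
        exact mul_le_one₀ (abs_liouville_le_one _) (abs_nonneg _) (abs_liouville_le_one _)
    _ = M := by
        rw [Finset.sum_const, Nat.card_Ioc, show 2 * M - M = M by omega]; simp

/-- Stub `stub_dilatedChowlaOfBinaryForms` of crux `FanDecorrelation` (line `SketchIdeator5`, stub 8):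
**binary-forms Chowla implies the route's rank-4 crux `DilatedChowla`** (stmt-Parity-13319).
Hypothesis: the binary-forms Chowla conjecture (stub 3a of the line, verbatim).  Conclusion: the body
of `Summit.Parity.GeneralizedHardyLittlewood.Theses.LiouvilleMAD.DilatedChowla` verbatim — for every
`c ≠ 0` there are `κ > 0`, `C` with `|Σ_{m∈(M,2M]} λ(mn+c)λ(mn'+c)| ≤ C·M^{1−κ}` for all `M` and
`1 ≤ n ≠ n' ≤ 2M`.  Instance `X = L = M`, `a₁ = a₂ = c` (non-proportional since `c ≠ 0`, `n ≠ n'`);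
`κ' = min κ (1/2)`, `C' = max C 0 + |c|`; scales `M ≤ |c|` by the trivial bound. [folklore] -/
theorem stub_dilatedChowlaOfBinaryForms :
    (∃ κ : ℝ, 0 < κ ∧ ∃ C : ℝ, ∀ X L n₁ n₂ : ℕ, ∀ a₁ a₂ : ℤ,
      L ≤ X → 1 ≤ n₁ → 1 ≤ n₂ → n₁ ≤ 2 * X → n₂ ≤ 2 * X →
        0 < (n₁ : ℤ) * X + a₁ → 0 < (n₂ : ℤ) * X + a₂ →
          |a₁| ≤ 2 * (n₁ : ℤ) * X → |a₂| ≤ 2 * (n₂ : ℤ) * X →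
            (n₁ : ℤ) * a₂ ≠ (n₂ : ℤ) * a₁ →
              |∑ u ∈ Finset.Ioc X (X + L),
                  (ArithmeticFunction.liouville (Int.toNat ((u : ℤ) * n₁ + a₁)) : ℝ) *
                    (ArithmeticFunction.liouville (Int.toNat ((u : ℤ) * n₂ + a₂)) : ℝ)| ≤
                C * (X : ℝ) ^ (1 - κ)) →
    ∀ c : ℤ, c ≠ 0 → ∃ κ : ℝ, 0 < κ ∧ ∃ C : ℝ, ∀ M n n' : ℕ,
      1 ≤ n → 1 ≤ n' → n ≠ n' → n ≤ 2 * M → n' ≤ 2 * M →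
        |∑ m ∈ Finset.Ioc M (2 * M),
            (ArithmeticFunction.liouville (Int.toNat ((m : ℤ) * n + c)) : ℝ) *
              (ArithmeticFunction.liouville (Int.toNat ((m : ℤ) * n' + c)) : ℝ)| ≤
          C * (M : ℝ) ^ (1 - κ) := by
  intro hB c hc
  obtain ⟨κ, hκ, C, hC⟩ := hB
  -- cap the exponent so that `M^{1-κ'} ≥ 1` for `M ≥ 1`
  set κ' : ℝ := min κ (1 / 2) with hκ'
  have hκ'pos : 0 < κ' := lt_min hκ (by norm_num)
  have hκ'le : κ' ≤ κ := min_le_left _ _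
  have hκ'half : κ' ≤ 1 / 2 := min_le_right _ _
  refine ⟨κ', hκ'pos, max C 0 + |(c : ℝ)|, ?_⟩
  intro M n n' hn hn' hnn' hnM hn'M
  have hM1 : 1 ≤ M := by omega
  have hM1r : (1 : ℝ) ≤ M := by exact_mod_cast hM1
  have hMpow1 : (1 : ℝ) ≤ (M : ℝ) ^ (1 - κ') := Real.one_le_rpow hM1r (by linarith)
  have hMpow0 : (0 : ℝ) ≤ (M : ℝ) ^ (1 - κ') := by linarith
  have hC0 : (0 : ℝ) ≤ max C 0 := le_max_right _ _
  have hc0 : (0 : ℝ) ≤ |(c : ℝ)| := abs_nonneg _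
  rcases le_or_gt (M : ℤ) |c| with hsmall | hlarge
  · -- small scales: `|S| ≤ M ≤ |c| ≤ (max C 0 + |c|)·M^{1-κ'}`
    have h1 : (M : ℝ) ≤ |(c : ℝ)| := by
      rw [← Int.cast_abs]; exact_mod_cast hsmall
    calc _ ≤ (M : ℝ) := abs_dilatedSum_le c M n n'
      _ ≤ |(c : ℝ)| := h1
      _ ≤ (max C 0 + |(c : ℝ)|) * 1 := by linarith
      _ ≤ (max C 0 + |(c : ℝ)|) * (M : ℝ) ^ (1 - κ') :=
          mul_le_mul_of_nonneg_left hMpow1 (by positivity)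
  · -- large scales: the binary-forms hypothesis with `X = L = M`, `a₁ = a₂ = c`
    have hpos : ∀ t : ℕ, 1 ≤ t → 0 < (t : ℤ) * M + c := by
      intro t ht
      have h1 : (M : ℤ) ≤ (t : ℤ) * M := by
        have : (1 : ℤ) ≤ t := by exact_mod_cast ht
        nlinarith
      have h2 : -(M : ℤ) < c := by
        have := neg_abs_le c
        omega
      linarith
    have hht : ∀ t : ℕ, 1 ≤ t → |c| ≤ 2 * (t : ℤ) * M := by
      intro t ht
      have : (1 : ℤ) ≤ t := by exact_mod_cast ht
      nlinarith
    have hne : (n : ℤ) * c ≠ (n' : ℤ) * c := by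
      intro h
      have : (n : ℤ) = n' := mul_right_cancel₀ hc h
      exact hnn' (by exact_mod_cast this)
    have key := hC M M n n' c c le_rfl hn hn' hnM hn'M (hpos n hn) (hpos n' hn') (hht n hn)
      (hht n' hn') hne
    rw [show M + M = 2 * M by ring] at key
    calc _ ≤ C * (M : ℝ) ^ (1 - κ) := key
      _ ≤ max C 0 * (M : ℝ) ^ (1 - κ) :=
          mul_le_mul_of_nonneg_right (le_max_left _ _) (Real.rpow_nonneg (by positivity) _)
      _ ≤ max C 0 * (M : ℝ) ^ (1 - κ') :=
          mul_le_mul_of_nonneg_left (Real.rpow_le_rpow_of_exponent_le hM1r (by linarith)) hC0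
      _ ≤ (max C 0 + |(c : ℝ)|) * (M : ℝ) ^ (1 - κ') :=
          mul_le_mul_of_nonneg_right (by linarith) hMpow0

/-- Curried corollary: the same with the hypothesis' data unpacked. [folklore] -/
theorem dilatedChowla_of_binaryForms {κ C : ℝ} (hκ : 0 < κ)
    (hC : ∀ X L n₁ n₂ : ℕ, ∀ a₁ a₂ : ℤ,
      L ≤ X → 1 ≤ n₁ → 1 ≤ n₂ → n₁ ≤ 2 * X → n₂ ≤ 2 * X →
        0 < (n₁ : ℤ) * X + a₁ → 0 < (n₂ : ℤ) * X + a₂ →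
          |a₁| ≤ 2 * (n₁ : ℤ) * X → |a₂| ≤ 2 * (n₂ : ℤ) * X →
            (n₁ : ℤ) * a₂ ≠ (n₂ : ℤ) * a₁ →
              |∑ u ∈ Finset.Ioc X (X + L),
                  (ArithmeticFunction.liouville (Int.toNat ((u : ℤ) * n₁ + a₁)) : ℝ) *
                    (ArithmeticFunction.liouville (Int.toNat ((u : ℤ) * n₂ + a₂)) : ℝ)| ≤
                C * (X : ℝ) ^ (1 - κ))
    (c : ℤ) (hc : c ≠ 0) :
    ∃ κ : ℝ, 0 < κ ∧ ∃ C : ℝ, ∀ M n n' : ℕ,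
      1 ≤ n → 1 ≤ n' → n ≠ n' → n ≤ 2 * M → n' ≤ 2 * M →
        |∑ m ∈ Finset.Ioc M (2 * M),
            (ArithmeticFunction.liouville (Int.toNat ((m : ℤ) * n + c)) : ℝ) *
              (ArithmeticFunction.liouville (Int.toNat ((m : ℤ) * n' + c)) : ℝ)| ≤
          C * (M : ℝ) ^ (1 - κ) :=
  stub_dilatedChowlaOfBinaryForms ⟨κ, hκ, C, hC⟩ c hc

end Summit.Parity.GeneralizedHardyLittlewood.Theorems.FanDecorrelation.DilatedChowlaOfBinaryForms
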